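import Summits.Ventures.HodgeRepro2.T7SupportBergmanConjTorus
import Summits.Ventures.HodgeRepro2.T7SupportKappaCartan
import Summits.Ventures.HodgeRepro2.T5SU11HyperbolicSubgroup

/-!
# A regular double coset at which the two-torus orbital integral does not vanish (support, seat p1)

`T7SupportBergmanConjTorus.torus_orbital_conj_at_inv_ne_zero` evaluates the bi-torus orbital integral of the
tori `T_A = K`, `T_B = h K h⁻¹` at `γ = h⁻¹`, where it equals `‖zⁿ‖²_k ≠ 0` — but `γ h = 1 ∈ K`, i.e.
`κ(γ) = 1` (`T7SupportKappaCartan.kappa_eq_one_iff`): the NON-regular double coset, the one excluded from an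
isolation through the invariant `κ`. This file moves the non-vanishing to a regular point: along the hyperbolic
one-parameter subgroup `a_t = su11 (cosh t) (sinh t)` (`T5SU11Cartan.hyp`) the elements `γ_t := a_t h⁻¹` have

  `κ(γ_t) = |a(γ_t h)|² = |a(a_t)|² = cosh² t`   (`kappa_hyp_mul_inv`),

so `κ(γ_t) ≠ 1` for every `t ≠ 0` (`kappa_hyp_mul_inv_ne_one`), while the orbital integral at `γ_t` is the
diagonal coefficient `⟨π_k(a_t) zⁿ, zⁿ⟩_k` (`torus_orbital_conj_hyp`), a continuous function of `t`
(`T5BergmanMatrixCoeff.continuous_matrixCoeff_of_differentiableOn`, `T5SU11HyperbolicSubgroup.continuous_hyp`)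
with value `‖zⁿ‖²_k ≠ 0` at `t = 0` (`hyp_zero`). Hence it is non-zero for all `t` in a punctured
neighbourhood of `0` (`eventually_torus_orbital_conj_hyp_ne_zero`), and in particular

  `∃ γ₀, κ(γ₀) ≠ 1 ∧ (the orbital integral at γ₀) ≠ 0`   (`exists_regular_torus_orbital_ne_zero`),

with `γ₀` as close to the non-regular coset as one likes (`exists_regular_torus_orbital_ne_zero_near`:
`1 < κ(γ₀) < 1 + ε`). This is the explicit-model half of «`a_{γ₀} ≠ 0` at a regular `γ₀`» (STATUS l. 14985 (4),
t7-x1's offer, taken by p1 at l. 14992); the passage from the model point to a rational point of the global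
group (weak approximation) is not in this file.

Explicit model only; nothing about the adelic group, the actual tori, or any period.
Blind lane: Mathlib + the HodgeRepro2 prefix only; no sorry; axioms ⊆ {propext, Classical.choice, Quot.sound}.
-/

namespace Summit.Ventures.HodgeRepro2.T7SupportBergmanRegularPoint

open MeasureTheory Metric Filter Topology
open T5SU11Unimodular T5SU11Fibration T5SU11Cartan T5SU11OneParameter T5SU11HyperbolicSubgroup
  T5BergmanCoefficient T5BergmanMatrixCoeff T5HaarCircle T7SupportBergmanTorusOrbital
  T7SupportBergmanConjTorus T7SupportKappaCartan

variable [MeasurableSpace Circle] [BorelSpace Circle]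

/-! ### The diagonal coefficient `g ↦ ⟨π_k(g) zⁿ, zⁿ⟩_k` -/

omit [MeasurableSpace Circle] [BorelSpace Circle] in
/-- the diagonal monomial coefficient is continuous on `SU(1,1)` -/
theorem continuous_diagCoeff (k n : ℕ) (hk : 2 ≤ k) :
    Continuous (matrixCoeff k (fun w => w ^ n) (fun w => w ^ n)) :=
  continuous_matrixCoeff_of_differentiableOn k hk _ (differentiableOn_monomial n)
    (T5BergmanFourier.integrableOn_monomial k n) _ (differentiableOn_monomial n)
    (T5BergmanFourier.integrableOn_monomial k n)

omit [MeasurableSpace Circle] [BorelSpace Circle] in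
/-- at `g = 1` the diagonal coefficient is the pairing `⟨zⁿ, zⁿ⟩_k` -/
theorem diagCoeff_one (k n : ℕ) :
    matrixCoeff k (fun w => w ^ n) (fun w => w ^ n) 1 = pairing k (fun w => w ^ n) (fun w => w ^ n) := by
  unfold matrixCoeff
  congr 1
  funext z
  exact act_one k _ z

omit [MeasurableSpace Circle] [BorelSpace Circle] in
/-- `⟨zⁿ, zⁿ⟩_k ≠ 0` (its real part is positive) -/
theorem diagCoeff_one_ne_zero (k n : ℕ) (hk : 2 ≤ k) :
    matrixCoeff k (fun w => w ^ n) (fun w => w ^ n) 1 ≠ 0 := by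
  rw [diagCoeff_one]
  intro h0
  have := T5BergmanMonomialNorm.pairing_monomial_self_pos k hk n
  rw [h0, Complex.zero_re] at this
  exact lt_irrefl _ this

omit [MeasurableSpace Circle] [BorelSpace Circle] in
/-- `t ↦ ⟨π_k(a_t) zⁿ, zⁿ⟩_k` is continuous -/
theorem continuous_diagCoeff_hyp (k n : ℕ) (hk : 2 ≤ k) :
    Continuous fun t : ℝ => matrixCoeff k (fun w => w ^ n) (fun w => w ^ n) (hyp t) :=
  (continuous_diagCoeff k n hk).comp continuous_hyp

omit [MeasurableSpace Circle] [BorelSpace Circle] in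
/-- **the diagonal coefficient does not vanish along `a_t` for `t` near `0`** -/
theorem eventually_diagCoeff_hyp_ne_zero (k n : ℕ) (hk : 2 ≤ k) :
    ∀ᶠ t in 𝓝 (0 : ℝ), matrixCoeff k (fun w => w ^ n) (fun w => w ^ n) (hyp t) ≠ 0 := by
  have h0 : matrixCoeff k (fun w => w ^ n) (fun w => w ^ n) (hyp 0) ≠ 0 := by
    rw [hyp_zero]
    exact diagCoeff_one_ne_zero k n hk
  exact (continuous_diagCoeff_hyp k n hk).continuousAt.eventually_ne h0

/-! ### The invariant `κ` along `γ_t = a_t h⁻¹` -/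

omit [MeasurableSpace Circle] [BorelSpace Circle] in
/-- `κ(a_t h⁻¹) = cosh² t` for the tori `K` and `h K h⁻¹` -/
theorem kappa_hyp_mul_inv (t : ℝ) (h : SU11) :
    T7SupportTwoTorusInvariant.kappa (starRingEnd ℂ) dd (colBasis h) (mat (hyp t * h⁻¹)) =
      ((Real.cosh t ^ 2 : ℝ) : ℂ) := by
  rw [kappa_eq_normSq, inv_mul_cancel_right, mat_hyp_zero_zero, Complex.normSq_ofReal, sq]

omit [MeasurableSpace Circle] [BorelSpace Circle] in
/-- `cosh² t ≠ 1` for `t ≠ 0` -/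
theorem cosh_sq_ne_one {t : ℝ} (ht : t ≠ 0) : Real.cosh t ^ 2 ≠ 1 := by
  have h1 : 1 < Real.cosh t := Real.one_lt_cosh.2 ht
  have h2 : 1 < Real.cosh t ^ 2 := by nlinarith
  exact h2.ne'

omit [MeasurableSpace Circle] [BorelSpace Circle] in
/-- **`γ_t = a_t h⁻¹` is regular for `t ≠ 0`**: `κ(γ_t) ≠ 1`, i.e. `γ_t h = a_t ∉ K` -/
theorem kappa_hyp_mul_inv_ne_one {t : ℝ} (ht : t ≠ 0) (h : SU11) :
    T7SupportTwoTorusInvariant.kappa (starRingEnd ℂ) dd (colBasis h) (mat (hyp t * h⁻¹)) ≠ 1 := by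
  rw [kappa_hyp_mul_inv, Ne, Complex.ofReal_eq_one]
  exact cosh_sq_ne_one ht

omit [MeasurableSpace Circle] [BorelSpace Circle] in
/-- `κ(γ_t) > 1` for `t ≠ 0` (real part) -/
theorem one_lt_kappa_hyp_mul_inv_re {t : ℝ} (ht : t ≠ 0) (h : SU11) :
    1 < (T7SupportTwoTorusInvariant.kappa (starRingEnd ℂ) dd (colBasis h) (mat (hyp t * h⁻¹))).re := by
  rw [kappa_hyp_mul_inv, Complex.ofReal_re]
  have h1 : 1 < Real.cosh t := Real.one_lt_cosh.2 ht
  nlinarith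

/-! ### The orbital integral along `γ_t` -/

/-- the orbital integral at `γ_t = a_t h⁻¹` (matching characters `p = k + 2n`, `q = −(k + 2n)`) is the diagonal
coefficient `⟨π_k(a_t) zⁿ, zⁿ⟩_k` -/
theorem torus_orbital_conj_hyp (k n : ℕ) (hk : 2 ≤ k) (h : SU11) (t : ℝ) :
    ∫ u : Circle, ∫ v : Circle,
        matrixCoeff k (act k h (fun w => w ^ n)) (fun w => w ^ n)
            (rot u * (hyp t * h⁻¹) * (h * rot v * h⁻¹)) *
          ((u : ℂ) ^ ((k + 2 * n : ℕ) : ℤ) * (starRingEnd ℂ) ((v : ℂ) ^ (-(k + 2 * n : ℕ) : ℤ)))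
          ∂haarCircle ∂haarCircle =
      matrixCoeff k (fun w => w ^ n) (fun w => w ^ n) (hyp t) := by
  rw [torus_orbital_conj_eq k n n hk h (hyp t * h⁻¹), if_pos rfl, if_pos rfl, one_mul, one_mul,
    inv_mul_cancel_right]

/-- **the orbital integral does not vanish at `γ_t` for all `t` near `0`** -/
theorem eventually_torus_orbital_conj_hyp_ne_zero (k n : ℕ) (hk : 2 ≤ k) (h : SU11) :
    ∀ᶠ t in 𝓝 (0 : ℝ),
      ∫ u : Circle, ∫ v : Circle,
        matrixCoeff k (act k h (fun w => w ^ n)) (fun w => w ^ n)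
            (rot u * (hyp t * h⁻¹) * (h * rot v * h⁻¹)) *
          ((u : ℂ) ^ ((k + 2 * n : ℕ) : ℤ) * (starRingEnd ℂ) ((v : ℂ) ^ (-(k + 2 * n : ℕ) : ℤ)))
          ∂haarCircle ∂haarCircle ≠ 0 := by
  filter_upwards [eventually_diagCoeff_hyp_ne_zero k n hk] with t ht
  rw [torus_orbital_conj_hyp k n hk h t]
  exact ht

/-- **a regular double coset with non-vanishing bi-period, arbitrarily close to the non-regular one**: for every
`ε > 0` there is `γ₀ ∈ SU(1,1)` with `1 < κ(γ₀) < 1 + ε` (so `κ(γ₀) ≠ 1`) and the orbital integral of the tori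
`K`, `h K h⁻¹` at `γ₀` (vectors `π_k(h) zⁿ`, `zⁿ`; characters `p = k + 2n`, `q = −(k + 2n)`) non-zero. -/
theorem exists_regular_torus_orbital_ne_zero_near (k n : ℕ) (hk : 2 ≤ k) (h : SU11) {ε : ℝ} (hε : 0 < ε) :
    ∃ γ₀ : SU11,
      1 < (T7SupportTwoTorusInvariant.kappa (starRingEnd ℂ) dd (colBasis h) (mat γ₀)).re ∧
      (T7SupportTwoTorusInvariant.kappa (starRingEnd ℂ) dd (colBasis h) (mat γ₀)).re < 1 + ε ∧
      ∫ u : Circle, ∫ v : Circle,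
        matrixCoeff k (act k h (fun w => w ^ n)) (fun w => w ^ n) (rot u * γ₀ * (h * rot v * h⁻¹)) *
          ((u : ℂ) ^ ((k + 2 * n : ℕ) : ℤ) * (starRingEnd ℂ) ((v : ℂ) ^ (-(k + 2 * n : ℕ) : ℤ)))
          ∂haarCircle ∂haarCircle ≠ 0 := by
  -- `cosh² t → 1` as `t → 0`
  have hc : ∀ᶠ t in 𝓝 (0 : ℝ), Real.cosh t ^ 2 < 1 + ε := by
    have hcont : Continuous fun t : ℝ => Real.cosh t ^ 2 := by fun_prop
    have h0 : Real.cosh (0 : ℝ) ^ 2 < 1 + ε := by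
      rw [Real.cosh_zero, one_pow]
      linarith
    exact hcont.continuousAt.eventually_lt continuousAt_const h0
  -- combine with the non-vanishing near `0`, and pick a point `t > 0` of the neighbourhood
  have hall := (eventually_torus_orbital_conj_hyp_ne_zero k n hk h).and hc
  have h' := (hall.filter_mono (nhdsWithin_le_nhds (s := Set.Ioi (0 : ℝ)))).and self_mem_nhdsWithin
  obtain ⟨t, ⟨hP, hc'⟩, ht⟩ := h'.exists
  refine ⟨hyp t * h⁻¹, one_lt_kappa_hyp_mul_inv_re (ne_of_gt ht) h, ?_, hP⟩
  rw [kappa_hyp_mul_inv, Complex.ofReal_re]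
  exact hc'

/-- **a regular double coset with non-vanishing bi-period**: `∃ γ₀ ∈ SU(1,1)` with `κ(γ₀) ≠ 1` (`γ₀ h ∉ K`,
`kappa_eq_one_iff`) and the orbital integral of the tori `K`, `h K h⁻¹` at `γ₀` non-zero — the explicit-model
half of «`a_{γ₀} ≠ 0` at a regular `γ₀`». -/
theorem exists_regular_torus_orbital_ne_zero (k n : ℕ) (hk : 2 ≤ k) (h : SU11) :
    ∃ γ₀ : SU11,
      T7SupportTwoTorusInvariant.kappa (starRingEnd ℂ) dd (colBasis h) (mat γ₀) ≠ 1 ∧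
      ∫ u : Circle, ∫ v : Circle,
        matrixCoeff k (act k h (fun w => w ^ n)) (fun w => w ^ n) (rot u * γ₀ * (h * rot v * h⁻¹)) *
          ((u : ℂ) ^ ((k + 2 * n : ℕ) : ℤ) * (starRingEnd ℂ) ((v : ℂ) ^ (-(k + 2 * n : ℕ) : ℤ)))
          ∂haarCircle ∂haarCircle ≠ 0 := by
  obtain ⟨γ₀, h1, -, hP⟩ := exists_regular_torus_orbital_ne_zero_near k n hk h one_pos
  refine ⟨γ₀, fun h0 => ?_, hP⟩
  rw [h0, Complex.one_re] at h1
  exact lt_irrefl _ h1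

end Summit.Ventures.HodgeRepro2.T7SupportBergmanRegularPoint
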